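/-
Origin: expansion seat `planner-pub-hodgecm-mc-axioms-1-g14-0`, handover #W47 2026-08-20T15:53:55Z md5 d325d1fbe67b (PKG 622b9d557065 → d325d1fbe67b; 150 l.; MECHANICAL (iib-R) rewrite v3.1 of the PKG file as it stands (94 token edits; rules R1x1+RX[h₂]x93)) (`HOME/mc/pub-hodgecm-mc-axioms-1-g14/revendor/kit-r55/stage55/HodgeCM/Model/E2InstanceR7.lean`, md5 d325d1fbe67b, 150 lines);
landed by the gen-22 packager (p-g22) in gate run 55 REPLACES the earlier landed copy of `HodgeCM/Model/E2InstanceR7.lean` (seat copy carried the packager Origin header of an earlier run (stripped)).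
-/
/-
Origin: CONSTRUCTION seat `planner-pub-hodgecm-mc-glue-1-g6-0` (unit pub-hodgecm-mc-glue-1-g6, gen 6 of mc-glue-1, node E ASSEMBLER), 2026-08-19T18:00Z — revision (§60) of `HodgeCM/Model/E2InstanceR7.lean` for RUN 37: the (Θ-sat-≤) ORDER CASCADE (BINDER-TRIAGE §60: theta saturation in the `K`-order `Γ' ≤ Γ :↔ Γ'.K ≤ Γ.K` of the (W1) `Level`-pair root, covers `cover Γ Γ' (Level.Γ_mono h)`), forced by the K-order `Model.thetaSatOf` (theta-3-g9 t37 #C2); kit `mc/pub-hodgecm-mc-glue-1-g6/t37c-mcglue1g6.txt`; base PKG (RUN-35 bytes, glue-1 lineage). REPLACE — binder `thetaSat` of `perL_picardCM_r7` re-typed to the K-order (1 binder), as R6. Kernel only: 0 `proof-hole`, 0 new declarations, cites nothing new; expected `#print axioms` unchanged (⊆ {propext, Classical.choice, Quot.sound}).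
-/
/-
Origin: expansion seat `planner-pub-hodgecm-mc-glue-1-g3-0`, handover #304 2026-08-19T00:39Z md5 4f00d1f4ad89af23d4aa1c1ac24aadba (NEW PKG leaf, 139 l.; node E END STATE revision 7 `Model.perL_picardCM_r7` : (picardCMUniverse hHD hI h₁ h₃).PerL at T := thetaModelOf … h (embOf …) (coverOf … hA) (wmOfInput W) (thetaOf _ (thetaClassInputOf _ X)) (d12Of μ) (d34Of μ); = perL_picardCM_r6 at wm := `Model.wmOfInput W` (NEW def := fun V c => unitary-1-g3 `wmOf' printFact_ (`HOME/mc/pub-hodgecm-mc-glue-1-g3/lean/E2InstanceR7.lean`, md5 4f00d1f4, 139 lines);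
landed by the gen-9 packager (p-g9) in gate run 33 as `HodgeCM/Model/E2InstanceR7.lean` (verbatim).
-/
/-
Origin: CONSTRUCTION seat `planner-pub-hodgecm-mc-glue-1-g3-0` (unit pub-hodgecm-mc-glue-1-g3, gen 3 of mc-glue-1,
node E ASSEMBLER), 2026-08-19.  NEW additive leaf `HodgeCM/Model/E2InstanceR7.lean`.  Imports: `E2InstanceR6`
(revision 6 and everything below it), `WmInstance` (mc-unitary-1-g3, node (v19-a): `Model.WmInput`, `Model.wmOf'`)
and `ThetaClassInputInstance` (mc-theta-3-g3: `Model.ThetaSpaceInput`, `Model.thetaClassInputOf`,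
`Model.SupplySituationAt`, `Model.classPacksOf_thetaModelOf`).
No proof holes; every undischarged input is an explicit binder.  Expected `#print axioms`:
{propext, Classical.choice, Quot.sound}.
-/
import Summits.HodgeConjecture.HodgeCM.Model.E2InstanceR6
import Summits.HodgeConjecture.HodgeCM.Model.WmInstance
import Summits.HodgeConjecture.HodgeCM.Model.ThetaClassInputInstance

/-!
# E2 instance, revision 7: `wm`, `I` (theta-class input) and `classPacks` PRODUCED

`Model.perL_picardCM_r7 : (picardCMUniverse hHD hI h₁ h₃).PerL` at the theta-model
`T := thetaModelOf hHD hI h₁ h₃ h (embOf …) (coverOf … hA) (wmOfInput W) (thetaOf _ (thetaClassInputOf _ X)) (d12Of μ)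
(d34Of μ)`, i.e. revision 6 with THREE binders replaced by producers of record.  (1) The MODEL-DATA binder of the
(v19-a) kind, `wm V c` (a Weil–theta model for the see-saw pair of
adelic quotients attached to `V` and `W_c`), REPLACED by mc-unitary-1-g3's producer of record
`Model.wmOf' printFact_unitaryCompact_holds (W V c)` (`HodgeCM/Model/WmInstance.lean` rev-b: the adelic Weil
representation restricted to the dual pair, its theta distribution and unfolding, built from the bundled input record
`W V c : Model.WmInput V c.D` — one field per section variable of `Model.wmOf`, nothing hidden), packaged here as the
family `Model.wmOfInput W := fun V c ↦ wmOf' printFact_unitaryCompact_holds (W V c)`.  (2) The theta-class input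
`I V c : ThetaClassInput U V c` (v21) := mc-theta-3-g3's CLASSICAL instance of record
`Model.thetaClassInputOf _ X V c = (X V c).toThetaClassInput` (`HodgeCM/Model/ThetaClassInputInstance.lean`; carvers'
ruling (J-lvl′) 2026-08-19T00:25:32Z, reading (B)) from the smaller input `X V c : Model.ThetaSpaceInput U V c` (one
Weil line pair per type index, the classical class-map data per level, the archimedean inclusion; NO theta space and
NO K-type — `Θ_k(Γ)` is now the span over ALL adelic K-type situations, `Model.thetaSpaceOf`).  (3) The supply binder
`classPacks` (J-W7a, `ClassSupplyPackN` shape) := `Model.classPacksOf_thetaModelOf … X … A` from ONE supply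
situation per good sextic context, type index `k ∈ {0,1}` and `N > 0` (binder `A`, record `Model.SupplySituationAt`:
a level, a K-type situation, the membership `fam` of the test function `φ_N`, and the holomorphy `hol` (W6b-hol));
the containments `char_mem`, `theta_sub` of the old pack are PROVED there.  The proof is `Model.perL_picardCM_r6` at
these three values — a definitional specialisation plus theta-3's producer; nothing of revision 6 is re-proved.

Remaining binders: `hHR`, `h`, `hA`, `W`, `X`, `μ`, `hBetti`, `hd`, `ha`, `hLiu`, `thetaSat`, `transl`, `A`,
`gen12`, `real34`, `lin`, `hyp12`, `hyp34` — of which `W`, `X`, `μ` are INPUT RECORDS / DATA (instances of record to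
come: mc-unitary-1-g3's announced `wmInputCM`, mc-theta-3-g3's announced `ThetaSpaceInputOf`) and the rest are statements, each
either a verbatim published theorem supplied at the call site (`hHR`, `hA`, `hd`, `ha`) or an explicit geometric /
automorphic input of the programme under adjudication (never cited, never minted).
-/

noncomputable section

open scoped TensorProduct InnerProductSpace Matrix

namespace HodgeCM

namespace Model

open HodgeCM.Universe (AdelicThetaCore AdelicThetaCore₀ SideData ThetaModel ModelAxiomsPerL)
open Literature.AlgebraicGeometry.HodgeTheory
open Literature.AlgebraicGeometry.ComplexMultiplication (Shimura1998_Thm3_isogenousPower Shimura1998_Thm2_Cor)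
open Literature.NumberTheory.Automorphic.PicardCM
open Literature.NumberTheory.Transcendental (Arapura2012_Cor_15_4_6)
open HodgeCM.CMTypeOps (inflate)
open HodgeCM.Model.SupplyInstance (LineSupplyData)
open HodgeCM.Model.SupplyResidual (ClassSupplyPackN)

variable (hHD : exists_isReal_hodgeModel) (hI : hodgePQ_independent_of_hodgeModel)
  (h₁ : BallQuotientUniformised)  (h₃ : CMAbelianVarietyRealised)

/-- **The Weil–theta model family of the end state at a bundled input `W`** (node (v19-a) PRODUCED):
`wmOfInput W V c := Model.wmOf' printFact_unitaryCompact_holds (W V c)` — mc-unitary-1-g3's producer of record at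
the package's proof of `PrintFact_unitaryCompact`, as a family over `(V, c)` of the exact type of the `wm` binder of
`Model.perL_picardCM` … `Model.perL_picardCM_r6`. -/
def wmOfInput (W : ∀ {L : CMField} {ι₁ : L →+* ℂ} (V : HermSpace3 L ι₁) (c : SeesawCtx L), WmInput V c.D) :
    ∀ {L : CMField} {ι₁ : L →+* ℂ} (V : HermSpace3 L ι₁) (c : SeesawCtx L),
      WeilThetaModel (V.latticeModel printFact_unitaryCompact_holds).toQuotientModel.G
        (V.latticeModel printFact_unitaryCompact_holds).toQuotientModel.Γ
        (c.D.latticeModelW printFact_unitaryCompact_holds).toQuotientModel.G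
        (c.D.latticeModelW printFact_unitaryCompact_holds).toQuotientModel.Γ :=
  fun V c => wmOf' printFact_unitaryCompact_holds (W V c)

/-- (Ported verbatim from the HodgeCMPerL package; no docstring in the source.) -/
@[simp] theorem wmOfInput_apply (W : ∀ {L : CMField} {ι₁ : L →+* ℂ} (V : HermSpace3 L ι₁) (c : SeesawCtx L), WmInput V c.D)
    {L : CMField} {ι₁ : L →+* ℂ} (V : HermSpace3 L ι₁) (c : SeesawCtx L) :
    wmOfInput W V c = wmOf' printFact_unitaryCompact_holds (W V c) := rfl

/-- **`PerL` holds in the `picardCMUniverse`, revision 7** — revision 6 with `wm := Model.wmOfInput W`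
(mc-unitary-1-g3), `I := Model.thetaClassInputOf _ X` and `classPacks := Model.classPacksOf_thetaModelOf … X … A`
(mc-theta-3-g3) substituted; every other binder is revision 6's under that substitution, and the proof is
`Model.perL_picardCM_r6` at those values. -/
theorem perL_picardCM_r7 (hHR : BettiUniverse.HodgeRiemann20) (h : Bool)
    (hA : Arapura2012_Cor_15_4_6)
    (W : ∀ {L : CMField} {ι₁ : L →+* ℂ} (V : HermSpace3 L ι₁) (c : SeesawCtx L), WmInput V c.D)
    (X : ∀ {L : CMField} {ι₁ : L →+* ℂ} (V : HermSpace3 L ι₁) (c : SeesawCtx L),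
      ThetaSpaceInput (picardCMUniverse hHD hI h₁ h₃) V c)
    (μ : ∀ {L : CMField}, SeesawCtx L → Fin 4 → NumberField.InfinitePlace L → ℤ)
    (hBetti : ∀ {L : CMField} {ι₁ : L →+* ℂ} (V : HermSpace3 L ι₁), EmbBettiSide hHD hI h₁ h₃ V)
    (hd : Shimura1998_Thm3_isogenousPower) (ha : Shimura1998_Thm2_Cor)
    (hLiu : ∀ {L : CMField} {ι₁ : L →+* ℂ} (V : HermSpace3 L ι₁) (c : SeesawCtx L),
      (thetaModelOf hHD hI h₁ h₃ h (embOf hHD hI h₁ h₃) (coverOf hHD hI h₁ h₃ hA) (wmOfInput W) (thetaOf _ (thetaClassInputOf _ X)) (d12Of μ) (d34Of μ)).GoodCtx ι₁ c → Module.finrank ℚ c.K = 6 →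
      ∀ (i : Fin 4) (Γ : Level V), ∃ (M : CMField) (k : c.K →+* M) (σ' : M →+* ℂ), σ'.comp k = c.σ ∧
        (thetaModelOf hHD hI h₁ h₃ h (embOf hHD hI h₁ h₃) (coverOf hHD hI h₁ h₃ hA) (wmOfInput W) (thetaOf _ (thetaClassInputOf _ X)) (d12Of μ) (d34Of μ)).Theta V c i Γ ⊆
          (picardCMUniverse hHD hI h₁ h₃).Uiso Γ M (inflate k (c.Ψ i)) σ')
    (thetaSat : ∀ {L : CMField} {ι₁ : L →+* ℂ} (V : HermSpace3 L ι₁) (c : SeesawCtx L)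
      (i : Fin 4) (Γ Γ' : Level V) (hle : Γ' ≤ Γ) (ω : (picardCMUniverse hHD hI h₁ h₃).CohC ((picardCMUniverse hHD hI h₁ h₃).pms L ι₁ V Γ) 1),
      ω ∈ (thetaModelOf hHD hI h₁ h₃ h (embOf hHD hI h₁ h₃) (coverOf hHD hI h₁ h₃ hA) (wmOfInput W) (thetaOf _ (thetaClassInputOf _ X)) (d12Of μ) (d34Of μ)).Theta V c i Γ →
        (picardCMUniverse hHD hI h₁ h₃).pullC (coverOf hHD hI h₁ h₃ hA Γ Γ' (Level.Γ_mono hle)) 1 ω ∈ (thetaModelOf hHD hI h₁ h₃ h (embOf hHD hI h₁ h₃) (coverOf hHD hI h₁ h₃ hA) (wmOfInput W) (thetaOf _ (thetaClassInputOf _ X)) (d12Of μ) (d34Of μ)).Theta V c i Γ')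
    (transl : ∀ {L : CMField} {ι₁ : L →+* ℂ} (V : HermSpace3 L ι₁) (c : SeesawCtx L)
      (hc : (thetaModelOf hHD hI h₁ h₃ h (embOf hHD hI h₁ h₃) (coverOf hHD hI h₁ h₃ hA) (wmOfInput W) (thetaOf _ (thetaClassInputOf _ X)) (d12Of μ) (d34Of μ)).GoodCtx ι₁ c) (hK : Module.finrank ℚ c.K = 6),
      ∀ γ ∈ (ballOf hHD hI h₁ h₃ V c (two_lt_finrank_of_goodCtx hHD hI h₁ h₃ hc hK)).Δ, ∀ (i : Fin 4) (Γ : Level V) (ω : (picardCMUniverse hHD hI h₁ h₃).CohC ((picardCMUniverse hHD hI h₁ h₃).pms L ι₁ V Γ) 1),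
      ω ∈ (thetaModelOf hHD hI h₁ h₃ h (embOf hHD hI h₁ h₃) (coverOf hHD hI h₁ h₃ hA) (wmOfInput W) (thetaOf _ (thetaClassInputOf _ X)) (d12Of μ) (d34Of μ)).Theta V c i Γ → ∃ (Γ' : Level V) (ω' : (picardCMUniverse hHD hI h₁ h₃).CohC ((picardCMUniverse hHD hI h₁ h₃).pms L ι₁ V Γ') 1),
        ω' ∈ (thetaModelOf hHD hI h₁ h₃ h (embOf hHD hI h₁ h₃) (coverOf hHD hI h₁ h₃ hA) (wmOfInput W) (thetaOf _ (thetaClassInputOf _ X)) (d12Of μ) (d34Of μ)).Theta V c i Γ' ∧ (ballOf hHD hI h₁ h₃ V c (two_lt_finrank_of_goodCtx hHD hI h₁ h₃ hc hK)).ev Γ' ω' =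
          fun x => (ballOf hHD hI h₁ h₃ V c (two_lt_finrank_of_goodCtx hHD hI h₁ h₃ hc hK)).J γ x *ᵥ (ballOf hHD hI h₁ h₃ V c (two_lt_finrank_of_goodCtx hHD hI h₁ h₃ hc hK)).ev Γ ω (γ • x))
    (A : ∀ {L : CMField} {ι₁ : L →+* ℂ} (V : HermSpace3 L ι₁) (c : SeesawCtx L),
      (thetaModelOf hHD hI h₁ h₃ h (embOf hHD hI h₁ h₃) (coverOf hHD hI h₁ h₃ hA) (wmOfInput W) (thetaOf _ (thetaClassInputOf _ X)) (d12Of μ) (d34Of μ)).GoodCtx ι₁ c → Module.finrank ℚ c.K = 6 →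
        ∀ k : Fin 4, k = 0 ∨ k = 1 → ∀ N : ℕ, 0 < N → SupplySituationAt (X V c) k N)
    (gen12 : ∀ {L : CMField} {ι₁ : L →+* ℂ} (V : HermSpace3 L ι₁) (c : SeesawCtx L),
      (thetaModelOf hHD hI h₁ h₃ h (embOf hHD hI h₁ h₃) (coverOf hHD hI h₁ h₃ hA) (wmOfInput W) (thetaOf _ (thetaClassInputOf _ X)) (d12Of μ) (d34Of μ)).GoodCtx ι₁ c → Module.finrank ℚ c.K = 6 →
      Nonempty ((thetaModelOf hHD hI h₁ h₃ h (embOf hHD hI h₁ h₃) (coverOf hHD hI h₁ h₃ hA) (wmOfInput W) (thetaOf _ (thetaClassInputOf _ X)) (d12Of μ) (d34Of μ)).Gen12FunBridge V c))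
    (real34 : ∀ {L : CMField} {ι₁ : L →+* ℂ} (V : HermSpace3 L ι₁) (c : SeesawCtx L),
      (thetaModelOf hHD hI h₁ h₃ h (embOf hHD hI h₁ h₃) (coverOf hHD hI h₁ h₃ hA) (wmOfInput W) (thetaOf _ (thetaClassInputOf _ X)) (d12Of μ) (d34Of μ)).GoodCtx ι₁ c → Module.finrank ℚ c.K = 6 →
      Nonempty ((thetaModelOf hHD hI h₁ h₃ h (embOf hHD hI h₁ h₃) (coverOf hHD hI h₁ h₃ hA) (wmOfInput W) (thetaOf _ (thetaClassInputOf _ X)) (d12Of μ) (d34Of μ)).Real34FunBridge V c))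
    (lin : ∀ {L : CMField} {ι₁ : L →+* ℂ} (V : HermSpace3 L ι₁) (c : SeesawCtx L), (wmOfInput W V c).LinearStr)
    (hyp12 : ∀ {L : CMField} {ι₁ : L →+* ℂ} (V : HermSpace3 L ι₁) (c : SeesawCtx L),
      (thetaModelOf hHD hI h₁ h₃ h (embOf hHD hI h₁ h₃) (coverOf hHD hI h₁ h₃ hA) (wmOfInput W) (thetaOf _ (thetaClassInputOf _ X)) (d12Of μ) (d34Of μ)).GoodCtx ι₁ c → Module.finrank ℚ c.K = 6 →
      Nonempty (((coreOf _ (embOf hHD hI h₁ h₃) (coverOf hHD hI h₁ h₃ hA) (wmOfInput W) (thetaOf _ (thetaClassInputOf _ X))).toCore h).HypSmoothCore12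
        (((coreOf _ (embOf hHD hI h₁ h₃) (coverOf hHD hI h₁ h₃ hA) (wmOfInput W) (thetaOf _ (thetaClassInputOf _ X))).toCore h).side12 (d12Of μ)) (((coreOf _ (embOf hHD hI h₁ h₃) (coverOf hHD hI h₁ h₃ hA) (wmOfInput W) (thetaOf _ (thetaClassInputOf _ X))).toCore h).side34 (d34Of μ))
        ((((coreOf _ (embOf hHD hI h₁ h₃) (coverOf hHD hI h₁ h₃ hA) (wmOfInput W) (thetaOf _ (thetaClassInputOf _ X))).toCore h).analyticKM (((coreOf _ (embOf hHD hI h₁ h₃) (coverOf hHD hI h₁ h₃ hA) (wmOfInput W) (thetaOf _ (thetaClassInputOf _ X))).toCore h).side12 (d12Of μ))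
          (((coreOf _ (embOf hHD hI h₁ h₃) (coverOf hHD hI h₁ h₃ hA) (wmOfInput W) (thetaOf _ (thetaClassInputOf _ X))).toCore h).side34 (d34Of μ))).toAnalytic) V c (ℓ := lin V c)))
    (hyp34 : ∀ {L : CMField} {ι₁ : L →+* ℂ} (V : HermSpace3 L ι₁) (c : SeesawCtx L),
      (thetaModelOf hHD hI h₁ h₃ h (embOf hHD hI h₁ h₃) (coverOf hHD hI h₁ h₃ hA) (wmOfInput W) (thetaOf _ (thetaClassInputOf _ X)) (d12Of μ) (d34Of μ)).GoodCtx ι₁ c → Module.finrank ℚ c.K = 6 →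
      Nonempty (((coreOf _ (embOf hHD hI h₁ h₃) (coverOf hHD hI h₁ h₃ hA) (wmOfInput W) (thetaOf _ (thetaClassInputOf _ X))).toCore h).HypSmoothCore34
        (((coreOf _ (embOf hHD hI h₁ h₃) (coverOf hHD hI h₁ h₃ hA) (wmOfInput W) (thetaOf _ (thetaClassInputOf _ X))).toCore h).side12 (d12Of μ)) (((coreOf _ (embOf hHD hI h₁ h₃) (coverOf hHD hI h₁ h₃ hA) (wmOfInput W) (thetaOf _ (thetaClassInputOf _ X))).toCore h).side34 (d34Of μ))
        ((((coreOf _ (embOf hHD hI h₁ h₃) (coverOf hHD hI h₁ h₃ hA) (wmOfInput W) (thetaOf _ (thetaClassInputOf _ X))).toCore h).analyticKM (((coreOf _ (embOf hHD hI h₁ h₃) (coverOf hHD hI h₁ h₃ hA) (wmOfInput W) (thetaOf _ (thetaClassInputOf _ X))).toCore h).side12 (d12Of μ))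
          (((coreOf _ (embOf hHD hI h₁ h₃) (coverOf hHD hI h₁ h₃ hA) (wmOfInput W) (thetaOf _ (thetaClassInputOf _ X))).toCore h).side34 (d34Of μ))).toAnalytic) V c (ℓ := lin V c))) :
    (picardCMUniverse hHD hI h₁ h₃).PerL :=
  perL_picardCM_r6 hHD hI h₁ h₃ hHR h hA (wmOfInput W) (thetaClassInputOf _ X) μ hBetti hd ha hLiu thetaSat transl
    (fun V c hc hK => classPacksOf_thetaModelOf hHD hI h₁ h₃ h (embOf hHD hI h₁ h₃) (coverOf hHD hI h₁ h₃ hA)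
      (wmOfInput W) X (d12Of μ) (d34Of μ) A V c hc hK)
    gen12 real34 lin hyp12 hyp34

end Model

end HodgeCM

end
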